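import Summits.Ventures.PercRepro.SixThreeReduce
import Summits.Ventures.PercRepro.SixThreeProfileB
import Summits.Ventures.PercRepro.SixThreeTwoLinesB

/-!
# PercRepro — the bridge from the profile tables to the planar inequalities (p2, gen 6)

The interface with p3's additive table (mine-2 §19.9): for a plane `G` with `g ≥ 4` points and profile `P = prof G`,
the types `t = 1, 2` of `PlanarIneqs` follow from the purely numerical inequalities

    (T-1)  3 · (N₃(g, P) − 1) ≤ Fsum 5 g P,          N₃(g, P) = Σ_{s=3}^{g} N_s(g, P),
    (T-2)  3 · (N₃(g, P) − 1 − (g − [g − 1 ∈ P])) ≤ Fsum 4 g P,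

through `card_R3_eq_sum`, `gprime_ge` and the profile lower bound `sum_R3_ge_Fsum`; type `t = 3` is kept in its raw
form (its demand `#{B ∈ R₃ : ρ(G ∖ B) = 3}` awaits the `C₂` bridge).  the compositions live in `SixThreeCompose.lean`.
-/

namespace PercRepro

namespace SixThree

open Finset ThmH

variable {α : Type*} [DecidableEq α] {M : Matroid α} [M.Finite]

/-- `N₃(g, P) = Σ_{s=3}^{g} N_s(g, P)`. -/
def N3 (g : ℕ) (P : Multiset ℕ) : ℕ := ∑ s ∈ Finset.Icc 3 g, Ns g P s

/-- The numerical table inequalities for types `1` and `2` at `(g, P)`. -/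
def TableIneq12 (g : ℕ) (P : Multiset ℕ) : Prop :=
  3 * ((N3 g P : ℚ) - 1) ≤ Fsum 5 g P ∧
  3 * ((N3 g P : ℚ) - 1 - ((g - (if g - 1 ∈ P then 1 else 0) : ℕ) : ℚ)) ≤ Fsum 4 g P

/-- **Types `1` and `2` from the table.**  For a plane `G` with `g ≥ 4` points, `TableIneq12 g (prof G)` together
with the raw type-`3` inequality gives `PlanarIneqs M G`. -/
theorem planarIneqs_of_table (hs : Simple M) {G : Finset α} (hG : G ∈ planes M) (hg4 : 4 ≤ G.card)
    (hT : TableIneq12 G.card (prof M G))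
    (h3 : M.eRk ((gr M \ G : Finset α) : Set α) = 3 →
      3 * ((((R3 M G).filter (fun B : Finset α => M.eRk ((G \ B : Finset α) : Set α) = 3)).card : ℚ)) ≤
        ∑ B ∈ R3 M G, vSupply M B 3) :
    PlanarIneqs M G := by
  obtain ⟨hT1, hT2⟩ := hT
  have hN : ((R3 M G).card : ℚ) = (N3 G.card (prof M G) : ℚ) := by
    unfold N3
    rw [card_R3_eq_sum hs hG]
  refine ⟨?_, ?_, h3⟩
  · intro _
    rw [hN]
    exact hT1.trans (sum_R3_ge_Fsum hs hG hg4 (by norm_num))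
  · intro _
    rw [hN]
    have hg := gprime_ge hs hG hg4
    have hg' : ((G.card - (if G.card - 1 ∈ prof M G then 1 else 0) : ℕ) : ℚ) ≤
        ((G.filter (fun a => M.eRk ((G.erase a : Finset α) : Set α) = 3)).card : ℚ) := by
      exact_mod_cast hg
    have := sum_R3_ge_Fsum hs hG hg4 (n := 4) (by norm_num)
    linarith

/-- `v(B, n) ≥ 0` for `n ≥ 2`. -/
theorem vSupply_nonneg (M : Matroid α) [M.Finite] (B : Finset α) {n : ℕ} (hn : 2 ≤ n) : 0 ≤ vSupply M B n := by
  unfold vSupply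
  have hΛ := Lam_nonneg M B
  have h1 : (0 : ℚ) ≤ (6 : ℚ) ^ (B.card - 3) := by positivity
  have h2 : (0 : ℚ) ≤ (B.card : ℚ) := by positivity
  have hw₁ : 0 ≤ w₁ M B := by unfold w₁; exact div_nonneg h1 (by linarith)
  have hw₂ : 0 ≤ w₂ M B := by unfold w₂; exact div_nonneg h1 (by linarith)
  have hw₂m : 0 ≤ w₂m M B := w₂m_nonneg M B
  have hn' : (0 : ℚ) ≤ 2 * (n : ℚ) - 3 := by
    have : (2 : ℚ) ≤ n := by exact_mod_cast hn
    linarith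
  have hc : (0 : ℚ) ≤ (((n - 2).choose 2 : ℕ) : ℚ) := by positivity
  have hnq : (0 : ℚ) ≤ (n : ℚ) := by positivity
  nlinarith [mul_nonneg hnq hw₁, mul_nonneg hn' hw₂, mul_nonneg hc hw₂m]

/-- **A `3`-point plane satisfies `PlanarIneqs`**: `R₃(G) = {G}`, every demand is `0`. -/
theorem planarIneqs_of_three_points {G : Finset α} (hG : G ∈ planes M) (hg3 : G.card = 3) :
    PlanarIneqs M G := by
  classical
  have hG3 := (mem_planes.1 hG).2.2
  -- `R₃(G) = {G}`
  have hR3 : R3 M G = {G} := by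
    ext B
    unfold R3
    rw [Finset.mem_filter, Finset.mem_powerset, Finset.mem_singleton]
    constructor
    · rintro ⟨hBG, hrB⟩
      apply Finset.eq_of_subset_of_card_le hBG
      rw [hg3]; exact three_le_card_of_eRk_eq_three hrB
    · rintro rfl
      exact ⟨Finset.Subset.refl _, hG3⟩
  have hpos : ∀ n, 2 ≤ n → 0 ≤ ∑ B ∈ R3 M G, vSupply M B n :=
    fun n hn => Finset.sum_nonneg (fun B _ => vSupply_nonneg M B hn)
  -- `g′ = 0`: removing a point of a triple leaves rank `2`
  have hg' : (G.filter (fun a => M.eRk ((G.erase a : Finset α) : Set α) = 3)).card = 0 := by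
    rw [Finset.card_eq_zero, Finset.filter_eq_empty_iff]
    intro a ha h3
    have := M.eRk_le_encard ((G.erase a : Finset α) : Set α)
    rw [h3, Set.encard_coe_eq_coe_finsetCard, Finset.card_erase_of_mem ha, hg3] at this
    exact absurd this (by decide)
  -- the type-`3` demand is `0`: `G ∖ G = ∅`
  have hd3 : ((R3 M G).filter (fun B : Finset α => M.eRk ((G \ B : Finset α) : Set α) = 3)).card = 0 := by
    rw [hR3, Finset.card_eq_zero, Finset.filter_eq_empty_iff]
    intro B hB
    rw [Finset.mem_singleton] at hB
    subst hB
    rw [Finset.sdiff_self, Finset.coe_empty, M.eRk_empty]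
    decide
  refine ⟨?_, ?_, ?_⟩
  · intro _
    rw [hR3, Finset.card_singleton, Finset.sum_singleton]
    have := vSupply_nonneg M G (n := 5) (by norm_num)
    norm_num
    linarith
  · intro _
    rw [hR3, Finset.card_singleton, hg', Finset.sum_singleton]
    have := vSupply_nonneg M G (n := 4) (by norm_num)
    norm_num
    linarith
  · intro _
    rw [hd3]
    have := hpos 3 (by norm_num)
    norm_num
    linarith

/-! ### The additive form of the profile function (p3's table) is dominated by the record form on real planes -/

/-- The additive `(s − 2)`-count: `N₅ − lp₅` at `s = 5`, the unclamped `Σ_m C(m, s−2) C(g−m, 2)` for `s ≥ 6`. -/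
def dsAdd (g : ℕ) (P : Multiset ℕ) (s : ℕ) : ℕ :=
  if s = 5 then Ns g P 5 - lps g P 5 else (Multiset.map (fun m => m.choose (s - 2) * (g - m).choose 2) P).sum

/-- The additive rest count `N_s − lp_s − dsAdd_s` (truncated at `0`). -/
def restsAdd (g : ℕ) (P : Multiset ℕ) (s : ℕ) : ℕ := Ns g P s - lps g P s - dsAdd g P s

/-- The ADDITIVE profile function (mine-2 §19.9 / p3's `planar_additive` form). -/
noncomputable def FsumAdd (n g : ℕ) (P : Multiset ℕ) : ℚ :=
  (Ns g P 3 : ℚ) * vTri n + ((Ns g P 4 - lps g P 4 : ℕ) : ℚ) * v4gen n + (lps g P 4 : ℚ) * v4col n +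
    ∑ s ∈ Finset.Icc 5 g, ((lps g P s : ℚ) * vlp n s + (dsAdd g P s : ℚ) * vd n s +
      (restsAdd g P s : ℚ) * vrest n s)

/-- An `s`-set (`s ≥ 6`) with a line through `s − 2` of its points has rank `3`. -/
theorem eRk_eq_three_of_line_plus_two (hs : Simple M) {G X L : Finset α} (hG : G ∈ planes M) (hX : X ⊆ G)
    (hL : L ∈ linesOf M G) {s : ℕ} (hs6 : 6 ≤ s) (hXs : X.card = s) (hLX : (L ∩ X).card = s - 2) :
    M.eRk (X : Set α) = 3 := by
  have hL' : L ∈ lines M := (Finset.mem_filter.1 hL).1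
  have hoff : 1 ≤ (X \ L).card := by
    have h := Finset.card_sdiff_add_card_inter X L
    rw [Finset.inter_comm, hLX, hXs] at h
    omega
  obtain ⟨p, hp⟩ := Finset.card_pos.1 hoff
  rw [Finset.mem_sdiff] at hp
  have hsub : insert p (L ∩ X) ⊆ X := Finset.insert_subset hp.1 Finset.inter_subset_right
  have hpg : p ∈ gr M := (mem_planes.1 hG).1 (hX hp.1)
  have h3 : M.eRk ((insert p (L ∩ X) : Finset α) : Set α) = 3 :=
    eRk_insert_eq_three hs hL' Finset.inter_subset_left (by omega) hpg hp.2
  apply le_antisymm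
  · rw [← (mem_planes.1 hG).2.2]; exact M.eRk_mono (Finset.coe_subset.2 hX)
  · rw [← h3]; exact M.eRk_mono (Finset.coe_subset.2 hsub)

/-- On a real plane the clamp of `ds` is inactive for `s ≥ 6`: `Σ_m C(m, s−2) C(g−m, 2) + lp_s ≤ N_s` (the
`(s − 2)`-type and lp sets are disjoint rank-`3` `s`-subsets). -/
theorem sum_line_plus_two_add_lps_le (hs : Simple M) {G : Finset α} (hG : G ∈ planes M) {s : ℕ} (hs6 : 6 ≤ s) :
    (Multiset.map (fun m => m.choose (s - 2) * (G.card - m).choose 2) (prof M G)).sum +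
      lps G.card (prof M G) s ≤ Ns G.card (prof M G) s := by
  classical
  have hGg : G ⊆ gr M := (mem_planes.1 hG).1
  rw [sum_prof_eq (M := M) G (fun m => m.choose (s - 2) * (G.card - m).choose 2)
    (by rw [Nat.choose_eq_zero_of_lt (by omega)]; ring)]
  rw [← card_line_plus_subsets hs (s := s) (j := 2) (by omega), ← card_R3s_lp hs hG (by omega),
    ← card_R3s hs hG (by omega)]
  -- both families are subsets of `R3s`, and disjoint
  set A := (G.powersetCard s).filter (fun X : Finset α => ∃ L ∈ linesOf M G, (L ∩ X).card = s - 2) with hA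
  set B := (R3s M G s).filter (fun B : Finset α => ∃ L ∈ linesOf M G, (L ∩ B).card = s - 1) with hB
  have hAsub : A ⊆ R3s M G s := by
    intro X hX
    rw [hA, Finset.mem_filter, Finset.mem_powersetCard] at hX
    obtain ⟨⟨hXG, hXs⟩, L, hL, hLX⟩ := hX
    unfold R3s
    rw [Finset.mem_filter, Finset.mem_powersetCard]
    exact ⟨⟨hXG, hXs⟩, eRk_eq_three_of_line_plus_two hs hG hXG hL hs6 hXs hLX⟩
  have hBsub : B ⊆ R3s M G s := Finset.filter_subset _ _
  have hdisj : Disjoint A B := by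
    rw [Finset.disjoint_left]
    intro X hXA hXB
    rw [hA, Finset.mem_filter, Finset.mem_powersetCard] at hXA
    rw [hB, Finset.mem_filter] at hXB
    obtain ⟨⟨-, hXs⟩, L, hL, hLX⟩ := hXA
    obtain ⟨-, L', hL', hL'X⟩ := hXB
    -- the two lines share `≥ s − 3 ≥ 3` points of `X`, so they coincide — but their traces differ
    have h := Finset.card_union_add_card_inter (L ∩ X) (L' ∩ X)
    have hun : ((L ∩ X) ∪ (L' ∩ X)).card ≤ s := by
      rw [← hXs]
      exact Finset.card_le_card (Finset.union_subset Finset.inter_subset_right Finset.inter_subset_right)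
    have h2 : 2 ≤ (L ∩ X ∩ (L' ∩ X)).card := by omega
    obtain ⟨u, hu, v, hv, huv⟩ := Finset.one_lt_card.1 h2
    simp only [Finset.mem_inter] at hu hv
    have hLL' := lines_eq_of_two_mem hs (Finset.mem_filter.1 hL).1 (Finset.mem_filter.1 hL').1
      hu.1.1 hv.1.1 hu.2.1 hv.2.1 huv
    rw [hLL'] at hLX
    omega
  have := Finset.card_le_card (Finset.union_subset hAsub hBsub)
  rw [Finset.card_union_of_disjoint hdisj] at this
  exact this

/-- **The additive form is dominated by the record form on a real plane** (`g ≥ 4`, `n ≥ 2`). -/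
theorem FsumAdd_le_Fsum (hs : Simple M) {G : Finset α} (hG : G ∈ planes M) {n : ℕ} (hn : 2 ≤ n) :
    FsumAdd n G.card (prof M G) ≤ Fsum n G.card (prof M G) := by
  unfold FsumAdd Fsum
  apply add_le_add (le_refl _)
  apply Finset.sum_le_sum
  intro s hs'
  rw [Finset.mem_Icc] at hs'
  suffices h : (dsAdd G.card (prof M G) s : ℚ) * vd n s + (restsAdd G.card (prof M G) s : ℚ) * vrest n s ≤
      (ds G.card (prof M G) s : ℚ) * vd n s + (rests G.card (prof M G) s : ℚ) * vrest n s by linarith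
  rcases Nat.eq_or_lt_of_le hs'.1 with h5 | h6
  · -- `s = 5`: `ds ≤ N₅ − lp₅ = dsAdd`, `restsAdd = 0`, and `vd ≤ vrest`
    subst h5
    have hdsA : dsAdd G.card (prof M G) 5 = Ns G.card (prof M G) 5 - lps G.card (prof M G) 5 := by
      unfold dsAdd; rw [if_pos rfl]
    have hrA : restsAdd G.card (prof M G) 5 = 0 := by
      unfold restsAdd; rw [hdsA]; omega
    have hdsle : ds G.card (prof M G) 5 ≤ Ns G.card (prof M G) 5 - lps G.card (prof M G) 5 := min_le_right _ _
    have hrests : rests G.card (prof M G) 5 = (Ns G.card (prof M G) 5 - lps G.card (prof M G) 5) -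
        ds G.card (prof M G) 5 := rfl
    have hvals : vd n 5 ≤ vrest n 5 := by
      unfold vd vrest
      exact vFun_antitone hn (Lrest_nonneg 5) (Lrest_le_Ld (le_refl 5))
    rw [hdsA, hrA, hrests, Nat.cast_sub hdsle]
    have hq : (ds G.card (prof M G) 5 : ℚ) ≤ ((Ns G.card (prof M G) 5 - lps G.card (prof M G) 5 : ℕ) : ℚ) := by
      exact_mod_cast hdsle
    push_cast
    nlinarith [mul_le_mul_of_nonneg_right (sub_nonneg.2 hq) (sub_nonneg.2 hvals)]
  · -- `s ≥ 6`: the clamp is inactive, both forms agree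
    have h6' : 6 ≤ s := h6
    have hle := sum_line_plus_two_add_lps_le hs hG h6'
    have hdsA : dsAdd G.card (prof M G) s =
        (Multiset.map (fun m => m.choose (s - 2) * (G.card - m).choose 2) (prof M G)).sum := by
      unfold dsAdd; rw [if_neg (by omega)]
    have hds : ds G.card (prof M G) s =
        (Multiset.map (fun m => m.choose (s - 2) * (G.card - m).choose 2) (prof M G)).sum := by
      unfold ds; exact min_eq_left (by omega)
    unfold restsAdd rests
    rw [hdsA, hds]

/-- The table inequalities in the ADDITIVE form (p3's `Δ_t ≥ 0` at `t = 1, 2`). -/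
def TableIneqAdd12 (g : ℕ) (P : Multiset ℕ) : Prop :=
  3 * ((N3 g P : ℚ) - 1) ≤ FsumAdd 5 g P ∧
  3 * ((N3 g P : ℚ) - 1 - ((g - (if g - 1 ∈ P then 1 else 0) : ℕ) : ℚ)) ≤ FsumAdd 4 g P

/-- On a real plane the additive table inequalities imply the record ones. -/
theorem tableIneq12_of_add (hs : Simple M) {G : Finset α} (hG : G ∈ planes M)
    (h : TableIneqAdd12 G.card (prof M G)) : TableIneq12 G.card (prof M G) :=
  ⟨h.1.trans (FsumAdd_le_Fsum hs hG (by norm_num)), h.2.trans (FsumAdd_le_Fsum hs hG (by norm_num))⟩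

/-! ### Type `3` from the table -/

/-- **Type `3` from the table.**  For a plane `G` with `g ≥ 4`: if the general row `3 (N₃ − C2gen) ≤ FsumAdd 3 g P`
holds whenever `G` is not a union of two lines, and the two-line row `3 (N₃ − C2gen + 2 · 2^c) ≤ FsumAdd 3 g P`
(`c = |L₁ ∩ L₂ ∩ G| ≤ 1`) holds for every two-line decomposition, then the raw type-`3` inequality holds. -/
theorem planarIneq3_of_table (hs : Simple M) {G : Finset α} (hG : G ∈ planes M) (hg4 : 4 ≤ G.card)
    (hgen : (∀ L ∈ linesOf M G, M.eRk ((G \ L : Finset α) : Set α) = 3) →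
      3 * ((N3 G.card (prof M G) : ℚ) - C2gen G.card (prof M G)) ≤ FsumAdd 3 G.card (prof M G))
    (htwo : ∀ L₁ L₂, TwoLines M G L₁ L₂ → 5 ≤ G.card → (∀ L ∈ linesOf M G, (L ∩ G).card + 2 ≤ G.card) →
      3 * ((N3 G.card (prof M G) : ℚ) - C2gen G.card (prof M G) + 2 * 2 ^ (L₁ ∩ L₂ ∩ G).card) ≤
        FsumAdd 3 G.card (prof M G)) :
    3 * ((((R3 M G).filter (fun B : Finset α => M.eRk ((G \ B : Finset α) : Set α) = 3)).card : ℚ)) ≤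
      ∑ B ∈ R3 M G, vSupply M B 3 := by
  have hN : ((R3 M G).card : ℚ) = (N3 G.card (prof M G) : ℚ) := by
    unfold N3
    rw [card_R3_eq_sum hs hG]
  have hF := (FsumAdd_le_Fsum hs hG (n := 3) (by norm_num)).trans (sum_R3_ge_Fsum hs hG hg4 (by norm_num))
  have hpos : 0 ≤ ∑ B ∈ R3 M G, vSupply M B 3 :=
    Finset.sum_nonneg (fun B _ => vSupply_nonneg M B (by norm_num))
  rcases demand3_cases hs hG hg4 with h0 | ⟨hg, hle⟩ | ⟨L₁, L₂, h12, hg5, hnl, hle⟩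
  · rw [h0]; push_cast; linarith
  · have hq : (((R3 M G).filter (fun B : Finset α => M.eRk ((G \ B : Finset α) : Set α) = 3)).card : ℚ) +
        C2gen G.card (prof M G) ≤ (R3 M G).card := by exact_mod_cast hle
    rw [hN] at hq
    have := hgen hg
    linarith
  · have hq : (((R3 M G).filter (fun B : Finset α => M.eRk ((G \ B : Finset α) : Set α) = 3)).card : ℚ) +
        C2gen G.card (prof M G) ≤ (R3 M G).card + 2 * 2 ^ (L₁ ∩ L₂ ∩ G).card := by exact_mod_cast hle
    rw [hN] at hq
    have := htwo L₁ L₂ h12 hg5 hnl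
    linarith

/-! ### The `4`-point planes (not in p3's table, `5 ≤ g ≤ 40`) -/

/-- A `4`-point plane has profile `∅` (generic) or `{3}` (a `3`-line plus a point). -/
theorem prof_of_four (hs : Simple M) {G : Finset α} (hG : G ∈ planes M) (hg4 : G.card = 4) :
    prof M G = 0 ∨ prof M G = {3} := by
  classical
  -- every entry is `3`, and there is at most one
  have hall : ∀ m ∈ prof M G, m = 3 := by
    intro m hm
    have := prof_mem_bounds hG hm
    omega
  have hone : (prof M G).card ≤ 1 := by
    have h := prof_at_most_one_long hs hG
    have : (prof M G).filter (fun m => G.card + 1 < 2 * m) = prof M G := by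
      rw [Multiset.filter_eq_self]
      intro m hm
      rw [hall m hm, hg4]
      norm_num
    rw [this] at h
    exact h
  rcases Nat.le_one_iff_eq_zero_or_eq_one.1 hone with h0 | h1
  · left; exact Multiset.card_eq_zero.1 h0
  · right
    obtain ⟨m, hm⟩ := Multiset.card_eq_one.1 h1
    rw [hm]
    rw [hall m (by rw [hm]; exact Multiset.mem_singleton_self m)]

/-- The type-`1`/`2` table inequalities at `g = 4`, profile `∅`. -/
theorem tableIneqAdd12_four_empty : TableIneqAdd12 4 0 := by
  unfold TableIneqAdd12 N3 FsumAdd Ns lps dsAdd restsAdd vTri vTriExact v4gen v4col vFun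
  simp only [Multiset.map_zero, Multiset.sum_zero]
  norm_num [Finset.sum_Icc_succ_top, Nat.choose]

/-- The type-`1`/`2` table inequalities at `g = 4`, profile `{3}`. -/
theorem tableIneqAdd12_four_three : TableIneqAdd12 4 {3} := by
  unfold TableIneqAdd12 N3 FsumAdd Ns lps dsAdd restsAdd vTri vTriExact v4gen v4col vFun
  simp only [Multiset.map_singleton, Multiset.sum_singleton]
  norm_num [Finset.sum_Icc_succ_top, Nat.choose]

/-- A `4`-point plane satisfies the type-`1`/`2` table inequalities. -/
theorem tableIneqAdd12_of_four (hs : Simple M) {G : Finset α} (hG : G ∈ planes M) (hg4 : G.card = 4) :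
    TableIneqAdd12 G.card (prof M G) := by
  rw [hg4]
  rcases prof_of_four hs hG hg4 with h | h
  · rw [h]; exact tableIneqAdd12_four_empty
  · rw [h]; exact tableIneqAdd12_four_three

/-- A `4`-point plane satisfies the raw type-`3` inequality (its demand is `0`). -/
theorem planarIneq3_of_four {G : Finset α} (hg4 : G.card = 4) :
    3 * ((((R3 M G).filter (fun B : Finset α => M.eRk ((G \ B : Finset α) : Set α) = 3)).card : ℚ)) ≤
      ∑ B ∈ R3 M G, vSupply M B 3 := by
  rw [demand3_eq_zero_of_four hg4]
  have := Finset.sum_nonneg (fun B (_ : B ∈ R3 M G) => vSupply_nonneg M B (n := 3) (by norm_num))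
  push_cast
  linarith

end SixThree

end PercRepro
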